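import Summits.Ventures.PercRepro.C041TriangleAnsatz
import Summits.Ventures.PercRepro.C041TriangleLeafStar2

/-!
# A DOUBLY-MARKED EXIT IS FREE, ONE-TYPE MARKS ARE FREE AFTER THE FIRST, AND THE LEAF AGAINST A LEAF WITH ANY MARKS
(mine-3, gen 67; C-041.md §21 (be))

Three identities of six-vectors carry the marks of a zone to the universal rays of §21 (ap):
`X(1,1) * w′ = L₀′ • X(1,1) + 2T₁′ • e_{T₁} + 2T₂′ • e_{T₂}` for EVERY `w′` (`X11_mul_eq`: the `(1,1)`-vertex kills the
`M`-coordinates, and the marks cone contains every `(1, x, y, 0, 0, 0)` with `x, y ≥ 2`), `w′ * e_{T₁} = L₁′ • e_{T₁}`, and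
`X(p,q) = X(1,1) + sh p • e_{T₁} + sh q • e_{T₂}`.  Since `θ_△(w, X(1,1))`, `θ_△(w, e_{T₁})`, `θ_△(w, e_{T₂})` are cone
elements for every cone element `w` (`InCone_thetaTri_any_marks'`, `InCone_thetaTri_eT1`, `InCone_thetaTri_eT2`):
**`InCone_thetaTri_mul_X11`** — `θ_△(w, X(1,1) * w′) ∈ cone` for all cone elements `w, w′`: a zone carrying a 1-mark
and a 2-mark at one exit of the triangle is in the cone against EVERYTHING, whatever else hangs there; with the
ray identity every `X(p,q)`, `p, q ≥ 1` (`InCone_thetaTri_mul_marks`); hence `H` for every pair of stars one of which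
has a leaf at `0` and a leaf at `1` (`InCone_thetaTri_V_V_marks`, `InCone_thetaTri_V_of_zero_one`).
**`InCone_thetaTri_mul_pow_v_one_of`** — one-type marks are free after the first: `θ_△(w, w′ * v 1) ∈ cone` gives
`θ_△(w, w′ * v 1 ^ p) ∈ cone` for every `p ≥ 1` (and the mirror).  **`InCone_thetaTri_leaf_leaf_marks`** — THEOREM
(LEAF × LEAF + MARKS): `θ_△(v c, v s * X(p, q)) ∈ cone` for all `c, s ∈ [0, 1]` and all `p, q ≥ 0`: with THEOREM
(LEAF × TWO-LEAF STAR) every `(1, m)` instance whose `m`-star has at most one interior leaf is settled.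
-/

namespace PercRepro

namespace RelaxedTriangle

open TreeClosure Finset

/-! ## The identities -/

/-- `X(1,1) * w = L₀ • X(1,1) + 2T₁ • e_{T₁} + 2T₂ • e_{T₂}` for every six-vector `w`. -/
theorem X11_mul_eq (w : Vec6) :
    v 1 * v 0 * w = w 0 • (v 1 * v 0) + (2 * (w 1 - w 0)) • ![0, 1, 0, 0, 0, 0]
      + (2 * (w 2 - w 0)) • ![0, 0, 1, 0, 0, 0] := by
  ext i
  simp only [Pi.mul_apply, Pi.add_apply, Pi.smul_apply, smul_eq_mul, v]
  fin_cases i <;> simp <;> ring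

/-- `w * e_{T₁} = L₁ • e_{T₁}`. -/
theorem mul_eT1_eq (w : Vec6) : w * ![0, 1, 0, 0, 0, 0] = w 1 • ![0, 1, 0, 0, 0, 0] := by
  ext i
  simp only [Pi.mul_apply, Pi.smul_apply, smul_eq_mul]
  fin_cases i <;> simp

/-- `w * e_{T₂} = L₂ • e_{T₂}`. -/
theorem mul_eT2_eq (w : Vec6) : w * ![0, 0, 1, 0, 0, 0] = w 2 • ![0, 0, 1, 0, 0, 0] := by
  ext i
  simp only [Pi.mul_apply, Pi.smul_apply, smul_eq_mul]
  fin_cases i <;> simp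

/-- `w * X(p,q) = X(1,1) * w + (sh p · L₁) • e_{T₁} + (sh q · L₂) • e_{T₂}` for `p, q ≥ 1`. -/
theorem mul_marks_eq (w : Vec6) (p q : ℕ) (hp : 1 ≤ p) (hq : 1 ≤ q) :
    w * (v 1 ^ p * v 0 ^ q) = v 1 * v 0 * w + (sh p * w 1) • ![0, 1, 0, 0, 0, 0]
      + (sh q * w 2) • ![0, 0, 1, 0, 0, 0] := by
  rw [pow_v_one_mul_pow_v_zero_eq_add p q hp hq, mul_add, mul_add, mul_smul_comm, mul_smul_comm, mul_eT1_eq,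
    mul_eT2_eq, smul_smul, smul_smul, mul_comm w (v 1 * v 0)]

/-- `w * X(p,0) = w * v 1 + (sh p · L₁) • e_{T₁}` for `p ≥ 1`. -/
theorem mul_pow_v_one_eq (w : Vec6) (p : ℕ) (hp : 1 ≤ p) :
    w * v 1 ^ p = w * v 1 + (sh p * w 1) • ![0, 1, 0, 0, 0, 0] := by
  rw [pow_v_one_eq_add p hp, mul_add, mul_smul_comm, mul_eT1_eq, smul_smul]

/-- `w * X(0,q) = w * v 0 + (sh q · L₂) • e_{T₂}` for `q ≥ 1`. -/
theorem mul_pow_v_zero_eq (w : Vec6) (q : ℕ) (hq : 1 ≤ q) :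
    w * v 0 ^ q = w * v 0 + (sh q * w 2) • ![0, 0, 1, 0, 0, 0] := by
  rw [pow_v_zero_eq_add q hq, mul_add, mul_smul_comm, mul_eT2_eq, smul_smul]

/-- The coordinates `L₀ ≤ L₁`, `L₀ ≤ L₂`, `0 ≤ L₀` of a cone element. -/
theorem coords_nonneg_of_InCone {w : Vec6} (hw : InCone w) : 0 ≤ w 0 ∧ w 0 ≤ w 1 ∧ w 0 ≤ w 2 := by
  have hK : K4 (w 0) (w 1 - w 0) (w 2 - w 0) (w 4 + w 5 - w 3) := K4v_of_InCone hw
  exact ⟨le_trans hK.k_nonneg hK.k_le_g, by linarith [hK.t1_nonneg], by linarith [hK.t2_nonneg]⟩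

/-! ## A doubly-marked exit is free -/

/-- **THEOREM (A DOUBLY-MARKED EXIT IS FREE)**: `θ_△(w, X(1,1) * w′) ∈ cone` for all cone elements `w, w′`. -/
theorem InCone_thetaTri_mul_X11 {w w' : Vec6} (hw : InCone w) (hw' : InCone w') :
    InCone (thetaTri w (v 1 * v 0 * w')) := by
  obtain ⟨h0, h1, h2⟩ := coords_nonneg_of_InCone hw'
  rw [X11_mul_eq, thetaTri_add_right, thetaTri_add_right, thetaTri_smul_right, thetaTri_smul_right,
    thetaTri_smul_right]
  refine ((InCone.smul _ h0 ?_).add (InCone.smul _ (by linarith) ?_)).add (InCone.smul _ (by linarith) ?_)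
  · have := InCone_thetaTri_any_marks' 1 1 hw
    simpa using this
  · rw [thetaTri_comm]; exact InCone_thetaTri_eT1 hw
  · rw [thetaTri_comm]; exact InCone_thetaTri_eT2 hw

/-- The mirror: the doubly-marked zone at the first exit. -/
theorem InCone_thetaTri_X11_mul {w w' : Vec6} (hw : InCone w) (hw' : InCone w') :
    InCone (thetaTri (v 1 * v 0 * w') w) := by
  rw [thetaTri_comm]; exact InCone_thetaTri_mul_X11 hw hw'

/-- **Every `X(p,q)`, `p, q ≥ 1`, at an exit is free**: `θ_△(w, w′ * X(p,q)) ∈ cone` for all cone elements `w, w′`. -/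
theorem InCone_thetaTri_mul_marks {w w' : Vec6} (hw : InCone w) (hw' : InCone w') (p q : ℕ) (hp : 1 ≤ p)
    (hq : 1 ≤ q) : InCone (thetaTri w (w' * (v 1 ^ p * v 0 ^ q))) := by
  obtain ⟨h0, h1, h2⟩ := coords_nonneg_of_InCone hw'
  rw [mul_marks_eq w' p q hp hq, thetaTri_add_right, thetaTri_add_right, thetaTri_smul_right, thetaTri_smul_right]
  refine ((InCone_thetaTri_mul_X11 hw hw').add
    (InCone.smul _ (mul_nonneg (sh_nonneg p hp) (by linarith)) ?_)).add
    (InCone.smul _ (mul_nonneg (sh_nonneg q hq) (by linarith)) ?_)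
  · rw [thetaTri_comm]; exact InCone_thetaTri_eT1 hw
  · rw [thetaTri_comm]; exact InCone_thetaTri_eT2 hw

/-- `H` for two stars one of which carries `X(p,q)`, `p, q ≥ 1`: `θ_△(V a, V b * X(p,q)) ∈ cone`. -/
theorem InCone_thetaTri_V_V_marks {m m' : ℕ} (a : Fin m → ℝ) (ha : ∀ i, 0 ≤ a i ∧ a i ≤ 1) (b : Fin m' → ℝ)
    (hb : ∀ i, 0 ≤ b i ∧ b i ≤ 1) (p q : ℕ) (hp : 1 ≤ p) (hq : 1 ≤ q) :
    InCone (thetaTri (V a) (V b * (v 1 ^ p * v 0 ^ q))) :=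
  InCone_thetaTri_mul_marks (InCone_V a ha) (InCone_V b hb) p q hp hq

/-- A product of generators over any finite index set is a cone element. -/
theorem InCone_prod_v {ι : Type*} (s : Finset ι) (b : ι → ℝ) (hb : ∀ i ∈ s, 0 ≤ b i ∧ b i ≤ 1) :
    InCone (∏ i ∈ s, v (b i)) :=
  Finset.prod_induction (fun i => v (b i)) InCone (fun _ _ hx hy => hx.mul hy) InCone_one
    (fun i hi => InCone_v _ (hb i hi))

/-- **`H` FOR EVERY STAR WITH A LEAF AT `1` AND A LEAF AT `0`**: if `b i = 1` and `b j = 0` for some `i ≠ j`, then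
`θ_△(V a, V b) ∈ cone` for every star `a`. -/
theorem InCone_thetaTri_V_of_zero_one {m m' : ℕ} (a : Fin m → ℝ) (ha : ∀ i, 0 ≤ a i ∧ a i ≤ 1) (b : Fin m' → ℝ)
    (hb : ∀ i, 0 ≤ b i ∧ b i ≤ 1) {i j : Fin m'} (hij : i ≠ j) (hi : b i = 1) (hj : b j = 0) :
    InCone (thetaTri (V a) (V b)) := by
  classical
  have e : V b = v 1 * v 0 * ∏ k ∈ (univ.erase i).erase j, v (b k) := by
    unfold V
    rw [← Finset.mul_prod_erase univ (fun k => v (b k)) (mem_univ i),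
      ← Finset.mul_prod_erase (univ.erase i) (fun k => v (b k)) (Finset.mem_erase.2 ⟨hij.symm, mem_univ j⟩),
      hi, hj, ← mul_assoc]
  rw [e]
  exact InCone_thetaTri_mul_X11 (InCone_V a ha) (InCone_prod_v _ b (fun k _ => hb k))

/-! ## One-type marks are free after the first -/

/-- If `θ_△(w, w′ * v 1) ∈ cone` then `θ_△(w, w′ * X(p,0)) ∈ cone` for every `p ≥ 1`. -/
theorem InCone_thetaTri_mul_pow_v_one_of {w w' : Vec6} (hw : InCone w) (hw' : InCone w')
    (h : InCone (thetaTri w (w' * v 1))) (p : ℕ) (hp : 1 ≤ p) : InCone (thetaTri w (w' * v 1 ^ p)) := by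
  obtain ⟨h0, h1, -⟩ := coords_nonneg_of_InCone hw'
  rw [mul_pow_v_one_eq w' p hp, thetaTri_add_right, thetaTri_smul_right]
  refine h.add (InCone.smul _ (mul_nonneg (sh_nonneg p hp) (by linarith)) ?_)
  rw [thetaTri_comm]; exact InCone_thetaTri_eT1 hw

/-- If `θ_△(w, w′ * v 0) ∈ cone` then `θ_△(w, w′ * X(0,q)) ∈ cone` for every `q ≥ 1`. -/
theorem InCone_thetaTri_mul_pow_v_zero_of {w w' : Vec6} (hw : InCone w) (hw' : InCone w')
    (h : InCone (thetaTri w (w' * v 0))) (q : ℕ) (hq : 1 ≤ q) : InCone (thetaTri w (w' * v 0 ^ q)) := by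
  obtain ⟨h0, -, h2⟩ := coords_nonneg_of_InCone hw'
  rw [mul_pow_v_zero_eq w' q hq, thetaTri_add_right, thetaTri_smul_right]
  refine h.add (InCone.smul _ (mul_nonneg (sh_nonneg q hq) (by linarith)) ?_)
  rw [thetaTri_comm]; exact InCone_thetaTri_eT2 hw

/-! ## The leaf against a leaf with any marks -/

/-- **THEOREM (LEAF × LEAF + MARKS)**: `θ_△(v c, v s * X(p,q)) ∈ cone` for all `c, s ∈ [0, 1]` and all `p, q ≥ 0`. -/
theorem InCone_thetaTri_leaf_leaf_marks (c s : ℝ) (hc : 0 ≤ c ∧ c ≤ 1) (hs : 0 ≤ s ∧ s ≤ 1) (p q : ℕ) :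
    InCone (thetaTri (v c) (v s * (v 1 ^ p * v 0 ^ q))) := by
  have hvc := InCone_v c hc
  have hvs := InCone_v s hs
  by_cases hp : p = 0
  · subst hp
    by_cases hq : q = 0
    · subst hq
      simp only [pow_zero, mul_one]
      exact thetaTri_v_InCone c s hc hs
    · simp only [pow_zero, one_mul]
      exact InCone_thetaTri_mul_pow_v_zero_of hvc hvs
        (InCone_thetaTri_leaf_star2 s 0 c hs ⟨le_rfl, zero_le_one⟩ hc) q (Nat.one_le_iff_ne_zero.mpr hq)
  · by_cases hq : q = 0
    · subst hq
      simp only [pow_zero, mul_one]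
      exact InCone_thetaTri_mul_pow_v_one_of hvc hvs
        (InCone_thetaTri_leaf_star2 s 1 c hs ⟨zero_le_one, le_rfl⟩ hc) p (Nat.one_le_iff_ne_zero.mpr hp)
    · exact InCone_thetaTri_mul_marks hvc hvs p q (Nat.one_le_iff_ne_zero.mpr hp) (Nat.one_le_iff_ne_zero.mpr hq)

/-- The pure-root form: `θ_△(v c, V b) ∈ cone` whenever every leaf of `b` but at most one lies in `{0, 1}`
is covered by `InCone_thetaTri_leaf_leaf_marks` up to the order of the leaves; the mirror statement. -/
theorem InCone_thetaTri_leaf_marks_leaf (c s : ℝ) (hc : 0 ≤ c ∧ c ≤ 1) (hs : 0 ≤ s ∧ s ≤ 1) (p q : ℕ) :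
    InCone (thetaTri (v s * (v 1 ^ p * v 0 ^ q)) (v c)) := by
  rw [thetaTri_comm]; exact InCone_thetaTri_leaf_leaf_marks c s hc hs p q

end RelaxedTriangle

end PercRepro
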